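import Summits.MatrixMultiplication.MatrixMultiplication.Theses.TetrahedronCarving
import HarnessLib

/-!
# WeightedK4PlacementBars — where the three `Flat` leaves of the weighted-`K₄` carving family sit
against the FULL family of explicit 4-party spectral points, for the two CW vehicle families in print
(decomp-mm lens 6 «barrier-complement carving», generation 17; arithmetic kernel of the closed-form
bars and tails; the numeric certificates live in HOME `decomp-mm-lens-6/g17/placement-numerics.md`)

THE SCHEMA (CVZ21 Thm. 9 transposed to 4-tensors, as in `TetraFlatIrreversibilityWindow`, but with
EVERY explicit spectral point instead of the uniform one). A certificate for `Flat(V)` = «`ω(V) ≤ f`»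
through a vehicle `t` is a degeneration `V_N ≤ t^{⊗m(N)}` plus `R̃(t^{⊗m}) ≤ R̃(t)^m`; for every point
`F` of the asymptotic spectrum of 4-tensors `F(V_N) ≤ F(t)^{m(N)}`, so the bound obtained is
`≥ floor_F := e_F(V)·log R̃(t)/log F(t)` with `e_F(V) = lim log F(V_N)/log N`. A BAR is one explicit `F`
with `floor_F > f`. The explicit family is `F^{θ'} ∘ π` (quantum functionals of Christandl–Vrana–Zuiddam,
universal spectral points of k-tensors, composed with a grouping `π` of the four legs): classes Q4
(four singletons), G01 / G12 (one pair block + two singletons), and the 2|2 and 1|3 flattening ranks.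
Targets `T_(s,r) = ⊠_{e ∈ E(K₄)} EPR_e(N^{w_e})` (hub edges `s`, rim edges `r`; tetra `(1,1)`, `f = 4`
↔ `TetraFlat`; cone `(2,1)`, `f = 6` ↔ `ConeFlat`; sesqui `(3,2)`, `f = 10` ↔ `SesquiFlat`):
`e_{F^{θ'}∘π} = Σ_B θ'_B·(weight of the edges LEAVING block B)` exactly (multiplicativity over the EPR
factors). Vehicles `cw_q^4 ∈ (ℂ^{q+1})^{⊗4}` (CVZ19 Def. 2.2.1) and `CW_q^4 ∈ (ℂ^{q+2})^{⊗4}`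
(BCKLOSW26 Def. 49): `R̃ ≥` 2|2-flattening rank `= q+2` (exact), `log F^{θ'}(πt) ≤ h := max_P Σ θ'_B H(P_B)`
over the support of `πt` in an adapted block basis (Strassen's upper support bound; the adapted supports
are free, so `h` is the value). Every BAR below is therefore a theorem modulo (i) universality of the
quantum functionals and (ii) one finite inequality.

WHAT THIS FILE CERTIFIES (kernel, integers ↔ real logs) — the CLOSED-FORM part:
 * `hubFloorCw d q = d·log(q+2)/log(q+1)`: the hub 1|3-flattening floor through `cw_q^4` (1-flattening
   rank `q+1`) for a target with hub exponent `d = 3s` — `f < hubFloorCw d q ↔ (q+1)^f < (q+2)^d`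
   (`lt_hubFloorCw_iff`). CONE (`d = f = 6`): barred for EVERY `q ≥ 1` (`six_lt_hubFloorCw_six`).
   SESQUI (`d = 9`, `f = 10`): barred iff `q ≤ 4` (`ten_lt_hubFloorCw_nine_iff`; `6⁹ > 5¹⁰`, `7⁹ < 6¹⁰`).
   TETRA (`d = 3`, `f = 4`): barred iff `q = 1` (`four_lt_hubFloorCw_three_iff`).
 * `unifFloorCWLower q = 6·log(q+2)/log(4(q+1))`: a certified LOWER bound for the uniform-θ (Q4) floor of
   the BIG tensor `CW_q^4` on `T(K₄)` (dual certificate `Q_v = (½; 1/(2(q+1)) × (q+1))` on every leg gives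
   `h_unif(CW_q^4) ≤ 1 + ½·log₂(q+1)`; `e_unif = 3`; in the cone / sesqui normalisation the SAME number
   bounds floor·4/f because `e_unif/f = 3/4` for every member of the family — the uniform functional is
   target-blind). `4 ≤ unifFloorCWLower q ↔ (4(q+1))^4 ≤ (q+2)^6` (`four_le_unifFloorCWLower_iff`), true
   for every `q ≥ 12` (`four_lt_unifFloorCWLower_of_twelve_le`; `14⁶ = 7529536 > 256·13⁴ = 7311616`) and
   false for `1 ≤ q ≤ 11` (`unifFloorCWLower_lt_four`) — the closed-form TAIL of the big-tensor bars; the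
   gap `q = 9, 10, 11` is closed by the numeric uniform certificates 4.0015 / 4.0311 / 4.0582 (g16 `B(q)`).
 * Bridges to the items: under `ConeFlat` the cone exponent is STRICTLY BELOW every `hubFloorCw 6 q`
   (`omegaCone_lt_hubFloorCw_of_coneFlat`), under `SesquiFlat` below `hubFloorCw 9 q` for `q ≤ 4`, i.e. no
   certificate through those vehicles can prove the leaf — the arithmetic shadow of the BAR.

WHAT IS NUMERIC (not in this file; 49 dual certificates, margins ≥ 1.5·10⁻³, in placement-numerics.md §3):
 * CONE through `CW_q^4`: G12 functional (pair block {rim,rim}, θ' ≈ (0.46,0.46,0.09) → (0.41,0.41,0.17))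
   floors 6.110 (q=1) ↗ 6.298 (q=11); Q4 with hub weight ≈ 0.44 → 0.40: 6.318 ↗ 6.416 (q = 12..16). With the
   tail above: **`ConeFlat` is barred through every `cw_q^4` and every `CW_q^4`.**
 * SESQUI through `CW_q^4`, `q ≥ 3`: G12 (θ' ≈ (0.87,0.08,0.05) → (0.61,0.24,0.15)) 10.0094 ↗ 10.145 (q=3..9),
   Q4 10.18 / 10.25 (q = 10, 11), tail; through `cw_q^4`, `q = 5..8`: G12 10.108 ↗ 10.146, then uniform.
   **`SesquiFlat` is barred through every `cw_q^4` and every `CW_q^4` except `CW_1^4`, `CW_2^4`** (open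
   w.r.t. the explicit family: non-flattening sup 9.371 / 9.454).
 * TETRA: no explicit functional bars inside g16's windows (`cw_q^4`, `3 ≤ q ≤ 8`; `CW_q^4`, `1 ≤ q ≤ 8`).
Window map of the family through `CW_q^4` by hub/rim ratio: `s/r = 1 → q ≤ 8`, `5/4, 4/3 → q ≤ 5`,
`3/2 → q ≤ 2`, `≥ 5/3 → ∅`; through `cw_q^4` only `(1,1)` has a window. Sources: [corpus:paper-arxiv-1812.06952
p.5–7] · [corpus:paper-arxiv-1709.07851 §3–4] · [corpus:paper-arxiv-1609.07476 p.13] · [corpus:paper-arxiv-2602.11975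
p.51–52] · tree `Theorems.TetraFlatIrreversibilityWindow` (the uniform-functional window, g16).
-/

noncomputable section

set_option linter.dupNamespace false

open Summit.MatrixMultiplication.MatrixMultiplication.Theorems.TetrahedronTensor
open Summit.MatrixMultiplication.MatrixMultiplication.Theorems.ConeTensor
open Summit.MatrixMultiplication.MatrixMultiplication.Theorems.SesquiTensor
open Summit.MatrixMultiplication.MatrixMultiplication.Theses.TetrahedronCarving

namespace Summit.MatrixMultiplication.MatrixMultiplication.Theorems.WeightedK4PlacementBars

/-! ## 1. The hub-flattening floor through the small tensor `cw_q^4` -/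

/-- The hub 1|3-flattening floor of a weighted-`K₄` target with hub exponent `d` (`= 3s`) through
`cw_q^4` (1-flattening rank `q+1`, `R̃ = q+2`): `d·log(q+2)/log(q+1)`.
[cite: ChristandlVranaZuiddam2021, Thm. 9] -/
def hubFloorCw (d q : ℕ) : ℝ := (d : ℝ) * Real.log ((q : ℝ) + 2) / Real.log ((q : ℝ) + 1)

/-- `log(q+1) > 0` for `q ≥ 1`. [folklore] -/
theorem log_succ_pos {q : ℕ} (hq : 1 ≤ q) : 0 < Real.log ((q : ℝ) + 1) := by
  apply Real.log_pos
  have : (1 : ℝ) ≤ q := by exact_mod_cast hq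
  linarith

/-- **Integer form of the hub-flattening bar: `f < d·log(q+2)/log(q+1) ↔ (q+1)^f < (q+2)^d`** (`q ≥ 1`).
[folklore] -/
theorem lt_hubFloorCw_iff {d f q : ℕ} (hq : 1 ≤ q) :
    (f : ℝ) < hubFloorCw d q ↔ (q + 1) ^ f < (q + 2) ^ d := by
  have hlog := log_succ_pos hq
  unfold hubFloorCw
  rw [lt_div_iff₀ hlog]
  have e1 : (f : ℝ) * Real.log ((q : ℝ) + 1) = Real.log ((((q : ℝ) + 1)) ^ f) := by
    rw [Real.log_pow]
  have e2 : (d : ℝ) * Real.log ((q : ℝ) + 2) = Real.log ((((q : ℝ) + 2)) ^ d) := by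
    rw [Real.log_pow]
  rw [e1, e2, Real.log_lt_log_iff (by positivity) (by positivity)]
  constructor
  · intro h
    exact_mod_cast h
  · intro h
    exact_mod_cast h

/-- **CONE: the hub flattening bars `ConeFlat` through EVERY `cw_q^4`** (`d = f = 6`:
`(q+1)⁶ < (q+2)⁶`). [folklore] -/
theorem six_lt_hubFloorCw_six {q : ℕ} (hq : 1 ≤ q) : (6 : ℝ) < hubFloorCw 6 q := by
  have h := (lt_hubFloorCw_iff (d := 6) (f := 6) hq).2
    (Nat.pow_lt_pow_left (by omega) (by norm_num))
  exact_mod_cast h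

/-- Auxiliary: `(q+2)⁹ ≤ (q+1)¹⁰` for `q ≥ 5` (`6(q+2) ≤ 7(q+1)` and `7⁹ < 6¹⁰ ≤ 6⁹(q+1)`). [folklore] -/
theorem pow_nine_le_pow_ten {q : ℕ} (h5 : 5 ≤ q) : (q + 2) ^ 9 ≤ (q + 1) ^ 10 := by
  have h1 : 6 * (q + 2) ≤ 7 * (q + 1) := by omega
  have h2 : (6 * (q + 2)) ^ 9 ≤ (7 * (q + 1)) ^ 9 := Nat.pow_le_pow_left h1 9
  have h3 : 7 ^ 9 ≤ 6 ^ 9 * (q + 1) := by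
    calc 7 ^ 9 ≤ 6 ^ 9 * 6 := by norm_num
      _ ≤ 6 ^ 9 * (q + 1) := Nat.mul_le_mul_left _ (by omega)
  have h4 : 6 ^ 9 * (q + 2) ^ 9 ≤ 6 ^ 9 * ((q + 1) ^ 9 * (q + 1)) := by
    calc 6 ^ 9 * (q + 2) ^ 9 = (6 * (q + 2)) ^ 9 := by ring
      _ ≤ (7 * (q + 1)) ^ 9 := h2
      _ = 7 ^ 9 * (q + 1) ^ 9 := by ring
      _ ≤ 6 ^ 9 * (q + 1) * (q + 1) ^ 9 := Nat.mul_le_mul_right _ h3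
      _ = 6 ^ 9 * ((q + 1) ^ 9 * (q + 1)) := by ring
  have h5' : (q + 2) ^ 9 ≤ (q + 1) ^ 9 * (q + 1) := Nat.le_of_mul_le_mul_left h4 (by norm_num)
  calc (q + 2) ^ 9 ≤ (q + 1) ^ 9 * (q + 1) := h5'
    _ = (q + 1) ^ 10 := by ring

/-- **SESQUI: the hub flattening bars `SesquiFlat` through `cw_q^4` iff `q ≤ 4`** (`d = 9`, `f = 10`:
`(q+1)¹⁰ < (q+2)⁹ ↔ q ≤ 4`; `2¹⁰ < 3⁹`, `3¹⁰ < 4⁹`, `4¹⁰ < 5⁹`, `5¹⁰ = 9765625 < 6⁹ = 10077696`,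
`6¹⁰ > 7⁹`). [folklore] -/
theorem ten_lt_hubFloorCw_nine_iff {q : ℕ} (hq : 1 ≤ q) :
    (10 : ℝ) < hubFloorCw 9 q ↔ q ≤ 4 := by
  have key : (q + 1) ^ 10 < (q + 2) ^ 9 ↔ q ≤ 4 := by
    constructor
    · intro h
      by_contra h5
      exact absurd (pow_nine_le_pow_ten (by omega)) (not_le.mpr h)
    · intro h4
      interval_cases q <;> norm_num
  have h := lt_hubFloorCw_iff (d := 9) (f := 10) hq
  rw [← key, ← h]
  norm_cast

/-- **TETRA: the hub flattening bars `TetraFlat` through `cw_q^4` iff `q = 1`** (`d = 3`, `f = 4`: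
`(q+1)⁴ < (q+2)³ ↔ q = 1`; for `q ≥ 2`: `27(q+2)³ ≤ 64(q+1)³ ≤ 27(q+1)⁴`). [folklore] -/
theorem four_lt_hubFloorCw_three_iff {q : ℕ} (hq : 1 ≤ q) :
    (4 : ℝ) < hubFloorCw 3 q ↔ q = 1 := by
  have key : (q + 1) ^ 4 < (q + 2) ^ 3 ↔ q = 1 := by
    constructor
    · intro h
      by_contra h2
      have h2' : 2 ≤ q := by omega
      have a1 : 3 * (q + 2) ≤ 4 * (q + 1) := by omega
      have a2 : (3 * (q + 2)) ^ 3 ≤ (4 * (q + 1)) ^ 3 := Nat.pow_le_pow_left a1 3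
      have a3 : 64 ≤ 27 * (q + 1) := by omega
      have a4 : 27 * (q + 2) ^ 3 ≤ 27 * ((q + 1) ^ 3 * (q + 1)) := by
        calc 27 * (q + 2) ^ 3 = (3 * (q + 2)) ^ 3 := by ring
          _ ≤ (4 * (q + 1)) ^ 3 := a2
          _ = 64 * (q + 1) ^ 3 := by ring
          _ ≤ 27 * (q + 1) * (q + 1) ^ 3 := Nat.mul_le_mul_right _ a3
          _ = 27 * ((q + 1) ^ 3 * (q + 1)) := by ring
      have a5 : (q + 2) ^ 3 ≤ (q + 1) ^ 3 * (q + 1) := Nat.le_of_mul_le_mul_left a4 (by norm_num)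
      have a6 : (q + 2) ^ 3 ≤ (q + 1) ^ 4 := by
        calc (q + 2) ^ 3 ≤ (q + 1) ^ 3 * (q + 1) := a5
          _ = (q + 1) ^ 4 := by ring
      omega
    · intro h1
      subst h1
      norm_num
  have h := lt_hubFloorCw_iff (d := 3) (f := 4) hq
  rw [← key, ← h]
  norm_cast

/-! ## 2. The uniform-functional tail through the big tensor `CW_q^4` -/

/-- A certified lower bound for the uniform quantum-functional floor of `CW_q^4` on `T(K₄)`:
`3·log₂(q+2)/(1 + ½·log₂(q+1)) = 6·log(q+2)/log(4(q+1))` (dual certificate with `Q_v(0) = ½`,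
`Q_v(i) = 1/(2(q+1))`). [cite: ChristandlVranaZuiddam2021, Thm. 9] -/
def unifFloorCWLower (q : ℕ) : ℝ := 6 * Real.log ((q : ℝ) + 2) / Real.log (4 * ((q : ℝ) + 1))

/-- `log(4(q+1)) > 0`. [folklore] -/
theorem log_four_mul_succ_pos (q : ℕ) : 0 < Real.log (4 * ((q : ℝ) + 1)) := by
  apply Real.log_pos
  have : (0 : ℝ) ≤ q := by exact_mod_cast Nat.zero_le q
  linarith

/-- **Integer form: `4 ≤ 6·log(q+2)/log(4(q+1)) ↔ (4(q+1))⁴ ≤ (q+2)⁶`.** [folklore] -/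
theorem four_le_unifFloorCWLower_iff (q : ℕ) :
    4 ≤ unifFloorCWLower q ↔ (4 * (q + 1)) ^ 4 ≤ (q + 2) ^ 6 := by
  have hlog := log_four_mul_succ_pos q
  unfold unifFloorCWLower
  rw [le_div_iff₀ hlog]
  have e1 : 4 * Real.log (4 * ((q : ℝ) + 1)) = Real.log ((4 * ((q : ℝ) + 1)) ^ 4) := by
    rw [Real.log_pow]; norm_num
  have e2 : 6 * Real.log ((q : ℝ) + 2) = Real.log ((((q : ℝ) + 2)) ^ 6) := by
    rw [Real.log_pow]; norm_num
  rw [e1, e2, Real.log_le_log_iff (by positivity) (by positivity)]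
  constructor
  · intro h
    exact_mod_cast h
  · intro h
    exact_mod_cast h

/-- **Strict integer form: `4 < … ↔ (4(q+1))⁴ < (q+2)⁶`.** [folklore] -/
theorem four_lt_unifFloorCWLower_iff (q : ℕ) :
    4 < unifFloorCWLower q ↔ (4 * (q + 1)) ^ 4 < (q + 2) ^ 6 := by
  have hlog := log_four_mul_succ_pos q
  unfold unifFloorCWLower
  rw [lt_div_iff₀ hlog]
  have e1 : 4 * Real.log (4 * ((q : ℝ) + 1)) = Real.log ((4 * ((q : ℝ) + 1)) ^ 4) := by
    rw [Real.log_pow]; norm_num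
  have e2 : 6 * Real.log ((q : ℝ) + 2) = Real.log ((((q : ℝ) + 2)) ^ 6) := by
    rw [Real.log_pow]; norm_num
  rw [e1, e2, Real.log_lt_log_iff (by positivity) (by positivity)]
  constructor
  · intro h
    exact_mod_cast h
  · intro h
    exact_mod_cast h

/-- **THE TAIL: `4 < 6·log(q+2)/log(4(q+1))` for every `q ≥ 12`** (`q = 12, 13` by evaluation; `q ≥ 14`:
`256·(q+1)⁴ < 256·(q+2)⁴ ≤ (q+2)²·(q+2)⁴`). Hence every member of the weighted-`K₄` family is barred
through `CW_q^4`, `q ≥ 12`, by the uniform functional alone (`e_unif/f = 3/4`). [folklore] -/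
theorem four_lt_unifFloorCWLower_of_twelve_le {q : ℕ} (h12 : 12 ≤ q) : 4 < unifFloorCWLower q := by
  rw [four_lt_unifFloorCWLower_iff]
  by_cases h14 : 14 ≤ q
  · have hsq : 256 ≤ (q + 2) ^ 2 := by nlinarith
    have hq4 : (q + 1) ^ 4 < (q + 2) ^ 4 := Nat.pow_lt_pow_left (by omega) (by norm_num)
    calc (4 * (q + 1)) ^ 4 = 256 * (q + 1) ^ 4 := by ring
      _ < 256 * (q + 2) ^ 4 := Nat.mul_lt_mul_of_pos_left hq4 (by norm_num)
      _ ≤ (q + 2) ^ 2 * (q + 2) ^ 4 := Nat.mul_le_mul_right _ hsq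
      _ = (q + 2) ^ 6 := by ring
  · interval_cases q <;> norm_num

/-- The complementary range: the closed-form uniform bound does NOT bar for `1 ≤ q ≤ 11`
(`(q+2)⁶ < (4(q+1))⁴` there; at `q = 11`: `13⁶ = 4826809 < 256·12⁴ = 5308416`) — the gap `q = 9, 10, 11`
of the big-tensor bar is closed only by the sharper numeric certificates `B(q)` = 4.0015, 4.0311, 4.0582.
[folklore] -/
theorem unifFloorCWLower_lt_four {q : ℕ} (hq : 1 ≤ q) (h11 : q ≤ 11) : unifFloorCWLower q < 4 := by
  rw [← not_le, four_le_unifFloorCWLower_iff, not_le]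
  interval_cases q <;> norm_num

/-! ## 3. Bridges to the items (the arithmetic shadow of the bars) -/

/-- **Under `ConeFlat` the cone exponent is strictly below every hub-flattening floor of `cw_q^4`:**
no certificate `cone_N ≤ (cw_q^4)^{⊗m}` can prove the leaf (item 34047), for any `q`. [folklore] -/
theorem omegaCone_lt_hubFloorCw_of_coneFlat (h : ConeFlat) {q : ℕ} (hq : 1 ≤ q) :
    omegaCone ℂ < hubFloorCw 6 q :=
  lt_of_le_of_lt h (six_lt_hubFloorCw_six hq)

/-- **Under `SesquiFlat` the sesqui exponent is strictly below the hub-flattening floor of `cw_q^4`,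
`q ≤ 4`** (item 27189; `q ≥ 5` is barred numerically / by the uniform functional, not by this floor).
[folklore] -/
theorem omegaSesqui_lt_hubFloorCw_of_sesquiFlat (h : SesquiFlat) {q : ℕ} (hq : 1 ≤ q) (h4 : q ≤ 4) :
    omegaSesqui ℂ < hubFloorCw 9 q :=
  lt_of_le_of_lt h ((ten_lt_hubFloorCw_nine_iff hq).2 h4)

/-- **Under `TetraFlat` the tetrahedron exponent is strictly below the certified uniform floor of
`CW_q^4` for every `q ≥ 12`** (item 33477: the big-tensor window closes in closed form from `q = 12` on;
`q = 9, 10, 11` numerically). [folklore] -/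
theorem omegaTetra_lt_unifFloorCWLower_of_tetraFlat (h : TetraFlat) {q : ℕ} (h12 : 12 ≤ q) :
    omegaTetra ℂ < unifFloorCWLower q :=
  lt_of_le_of_lt h (four_lt_unifFloorCWLower_of_twelve_le h12)

/-- Summary of the closed-form placement (kernel part). [folklore] -/
theorem placement_summary :
    (∀ q : ℕ, 1 ≤ q → (6 : ℝ) < hubFloorCw 6 q) ∧
    (∀ q : ℕ, 1 ≤ q → ((10 : ℝ) < hubFloorCw 9 q ↔ q ≤ 4)) ∧
    (∀ q : ℕ, 1 ≤ q → ((4 : ℝ) < hubFloorCw 3 q ↔ q = 1)) ∧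
    (∀ q : ℕ, 12 ≤ q → 4 < unifFloorCWLower q) ∧
    (∀ q : ℕ, 1 ≤ q → q ≤ 11 → unifFloorCWLower q < 4) :=
  ⟨fun _ hq => six_lt_hubFloorCw_six hq, fun _ hq => ten_lt_hubFloorCw_nine_iff hq,
   fun _ hq => four_lt_hubFloorCw_three_iff hq, fun _ h => four_lt_unifFloorCWLower_of_twelve_le h,
   fun _ hq h11 => unifFloorCWLower_lt_four hq h11⟩

end Summit.MatrixMultiplication.MatrixMultiplication.Theorems.WeightedK4PlacementBars

end
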